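import Literature.MathematicalPhysics.QuantumFieldTheory.THooftElectricFlux
import Literature.MathematicalPhysics.QuantumFieldTheory.PlaquetteFieldTwistBound
import Mathlib.NumberTheory.LegendreSymbol.AddCharacter
import HarnessLib

/-!
# Every non-zero 't Hooft electric flux is heavy at strong coupling: `|e^{-βF(e,m)}| ≤ (e^{η} - 1) · W{m}`,
# `η = 2d² L^d e^{-L²}`, on the symmetric torus — from the all-sector twist bound and `ℤ_N` character orthogonality

Topic `Literature/MathematicalPhysics/QuantumFieldTheory`; vocabulary of `THooftElectricFlux.lean` (namespace `THooftFlux`: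
`temporalTensor k`, `fluxCharacter e k`, `electricFluxWeight N L β m e` = 't Hooft's (5.4)), `QuantumLattice/TwistedSectorClassicalRate.lean`
(`TwistedSector.twistZ`, `twistZ_pos`) and `PlaquetteFieldTwistBound.lean` (namespace `CentralTwist`: `abs_log_twistZ_sub_log_twistZ_le` — for
`|β| ≤ 1/(4N (8(d-1)+1)² e²)` and ANY two twists, `|ln W{n₁} - ln W{n₂}| ≤ 2d² L^d e^{-L²}`).  THEOREMS ONLY (no definition, no fact).

G. 't Hooft, Nucl. Phys. B153 (1979) 141 [tHooft1979Flux] §5 (5.4) `e^{-βF(e,m;a,β)} = (1/N³) Σ_k e^{-2πi(k·e)/N} W{k, m; a_μ}`; §7.2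
"Heavy fluxes … For all other values of (e, m) the free energy F must not tend to zero as `a, β` become large … the heavy fluxes cannot
spread out … `E(e₁, 0, 0, a, β → ∞) = ρ a₁` (7.5) … From now on we will assume that the magnetic fluxes are light and the electric ones
heavy (confinement mode)"; §10 (10.8)/(10.10): `W → 1 - const·e^{-Σ₁ρ}` in the confinement phase.  E. T. Tomboulis, arXiv:0707.2179
[Tomboulis2007Confinement] §6.1 (6.2)–(6.3): the electric-flux free energy as the `Z(N)` Fourier transform of the vortex free energy, area
law ⇔ confinement; K. R. Ito, E. Seiler, arXiv:0803.3019 [ItoSeiler2008Further] Thm 2.2 (1) (strong coupling).  Here, on `(ℤ/Lℤ)^{n+1}`: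

* `sum_fluxCharacter` — `Σ_k e^{-2πi(k·e)/N} = N^n · [e = 0]` (orthogonality of the characters of `ℤ_N^n`,
  `ZMod.isPrimitive_stdAddChar`);
* `electricFluxWeight_eq_sum_sub` — for `e ≠ 0`: `N^n · e^{-βF(e,m)} = Σ_k e^{-2πi(k·e)/N} (W{m+k} - W{m})`;
* ★★ `norm_electricFluxWeight_le` — for `|β| ≤ 1/(4N (8n+1)² e²)`, `n ≥ 1`, every base tensor `m` and every electric flux `e ≠ 0`:
  `‖e^{-βF(e,m)}‖ ≤ (e^{η} - 1) · W{m}` with `η = 2(n+1)² L^{n+1} e^{-L²}` — since every temporal sector satisfies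
  `|W{m+k}/W{m} - 1| ≤ e^{η} - 1` (`CentralTwist.abs_log_twistZ_sub_log_twistZ_le`); and relative to the zero-flux weight,
  ★★ `norm_electricFluxWeight_le_mul_zero` — `‖e^{-βF(e,m)}‖ ≤ e^{η}(e^{η} - 1) · e^{-βF(0,m)}`: the Boltzmann weight of EVERY
  non-zero electric flux is exponentially small in the cross-section `L²` at strong coupling, uniformly in `e` and in the magnetic
  sector `m` — 't Hooft's "heavy electric fluxes" (confinement mode) at strong coupling, finite symmetric box;
* Revision 1 — ★★ `abs_log_re_electricFluxWeight_zero_sub_le`: for ANY two base tensors `m, m'`,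
  `|ln e^{-βF(0,m)} - ln e^{-βF(0,m')}| ≤ η` ('t Hooft's "light magnetic fluxes", §7.1 and §8 (8.10)–(8.11), at strong coupling), with
  `re_electricFluxWeight_zero_pos` (`e^{-βF(0,m)} > 0`, real: `im_electricFluxWeight_zero`) and the combined
  `norm_electricFluxWeight_le_mul_zero_of_ne` (`‖e^{-βF(e,m)}‖ ≤ e^{2η}(e^{η} - 1) · e^{-βF(0,m')}`, `e ≠ 0`, any `m, m'`).

HONEST FRAMING: finite symmetric torus (all `a_μ = L`), strong coupling only, `SU(N)` fundamental Wilson action; no limit `a_μ → ∞`, no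
string tension extracted (the rate `L²` in `η` is the area-law exponent with the non-optimal constant `1`, not the string constant `ρ` of
(7.5)/(8.11)), and nothing at weak coupling.
-/

noncomputable section

open Finset
open scoped BigOperators
open Literature.MathematicalPhysics.QuantumLattice

namespace Literature.MathematicalPhysics.QuantumFieldTheory

namespace THooftFlux

variable {N n : ℕ} [NeZero N]

/-! ## Character orthogonality on `ℤ_N^n` -/

/-- One-dimensional orthogonality: `Σ_{x ∈ ℤ_N} e^{-2πi x a/N} = N · [a = 0]`.
[cite: tHooft1979Flux, §5 eqs. (5.2)–(5.4)] -/
theorem sum_stdAddChar_neg_mul (a : ZMod N) :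
    ∑ x : ZMod N, (ZMod.stdAddChar (N := N)) (-(x * a)) = if a = 0 then (N : ℂ) else 0 := by
  have h := AddChar.sum_mulShift (R := ZMod N) (-a) (ZMod.isPrimitive_stdAddChar N)
  simp_rw [mul_neg] at h
  rw [h, ZMod.card]
  by_cases ha : a = 0
  · simp [ha]
  · simp [ha]

/-- **Orthogonality of the Fourier kernel**: `Σ_{k ∈ ℤ_N^n} e^{-2πi(k·e)/N} = N^n` if `e = 0` and `0` otherwise (the projector
property behind (5.2): `P(e,m) = N^{-3} Σ_k e^{-2πi(k·e)/N} Ω[k]`). [cite: tHooft1979Flux, §5 eqs. (5.2)–(5.4)] -/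
theorem sum_fluxCharacter (e : Fin n → ZMod N) :
    ∑ k : Fin n → ZMod N, fluxCharacter e k = if e = 0 then (N : ℂ) ^ n else 0 := by
  classical
  have hprod := Finset.sum_prod_piFinset (Finset.univ : Finset (ZMod N))
    (fun (j : Fin n) (x : ZMod N) => (ZMod.stdAddChar (N := N)) (-(x * e j)))
  rw [Fintype.piFinset_univ] at hprod
  unfold fluxCharacter
  rw [hprod]
  simp_rw [sum_stdAddChar_neg_mul]
  by_cases he : e = 0
  · subst he
    simp
  · rw [if_neg he]
    obtain ⟨j, hj⟩ : ∃ j, e j ≠ 0 := by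
      by_contra h
      push Not at h
      exact he (funext h)
    exact Finset.prod_eq_zero (Finset.mem_univ j) (if_neg hj)

/-! ## The electric-flux weight as a sum of sector differences -/

/-- For a NON-ZERO electric flux the constant sector drops out: `N^n e^{-βF(e,m)} = Σ_k e^{-2πi(k·e)/N} (W{m+k} - W{m})`.
[cite: tHooft1979Flux, §5 eq. (5.4)] -/
theorem electricFluxWeight_eq_sum_sub (L : ℕ) [NeZero L] (β : ℝ) (m : QuantumLattice.Plane (n + 1) → ZMod N)
    {e : Fin n → ZMod N} (he : e ≠ 0) :
    electricFluxWeight N L β m e =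
      ((N : ℂ) ^ n)⁻¹ * ∑ k : Fin n → ZMod N, fluxCharacter e k *
        ((TwistedSector.twistZ (fundamentalRep (Fin N)) (QuantumLattice.twistOfTensor N (m + temporalTensor k)) β L : ℂ) -
          (TwistedSector.twistZ (fundamentalRep (Fin N)) (QuantumLattice.twistOfTensor N m) β L : ℂ)) := by
  rw [electricFluxWeight_def]
  congr 1
  have h0 : ∑ k : Fin n → ZMod N, fluxCharacter e k *
      (TwistedSector.twistZ (fundamentalRep (Fin N)) (QuantumLattice.twistOfTensor N m) β L : ℂ) = 0 := by
    rw [← Finset.sum_mul, sum_fluxCharacter, if_neg he, zero_mul]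
  rw [← sub_zero (∑ k : Fin n → ZMod N, fluxCharacter e k *
    (TwistedSector.twistZ (fundamentalRep (Fin N)) (QuantumLattice.twistOfTensor N (m + temporalTensor k)) β L : ℂ)), ← h0,
    ← Finset.sum_sub_distrib]
  exact Finset.sum_congr rfl fun k _ => by ring

/-! ## Heaviness of every non-zero electric flux at strong coupling -/

section StrongCoupling

omit [NeZero N] in
/-- `|x/y - 1| ≤ e^{η} - 1` from `|ln x - ln y| ≤ η` for positive `x, y` (plumbing). [folklore] -/
private theorem abs_div_sub_one_le_of_abs_log_sub_le {x y η : ℝ} (hx : 0 < x) (hy : 0 < y)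
    (h : |Real.log x - Real.log y| ≤ η) : |x / y - 1| ≤ Real.exp η - 1 := by
  have hxy : 0 < x / y := div_pos hx hy
  have hlog : |Real.log (x / y)| ≤ η := by rwa [Real.log_div hx.ne' hy.ne']
  have hη : 0 ≤ η := (abs_nonneg _).trans hlog
  rw [abs_le] at hlog ⊢
  constructor
  · -- lower: x/y ≥ e^{-η} ≥ 2 - e^{η}, i.e. x/y - 1 ≥ -(e^η - 1)
    have h1 : Real.exp (-η) ≤ x / y := by
      rw [← Real.exp_log hxy]
      exact Real.exp_le_exp.2 hlog.1
    have h2 : 2 - Real.exp η ≤ Real.exp (-η) := by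
      have := Real.add_one_le_exp η
      have := Real.add_one_le_exp (-η)
      have hprod : Real.exp η * Real.exp (-η) = 1 := by rw [← Real.exp_add, add_neg_cancel, Real.exp_zero]
      nlinarith [Real.exp_pos η, Real.exp_pos (-η)]
    linarith
  · have h1 : x / y ≤ Real.exp η := by
      rw [← Real.exp_log hxy]
      exact Real.exp_le_exp.2 hlog.2
    linarith

/-- **★★ Every non-zero electric flux is heavy at strong coupling** ('t Hooft 1979 §7.2 "heavy fluxes", confinement mode, here PROVED
at strong coupling on the finite symmetric torus): for the `SU(N)` Wilson theory on `(ℤ/Lℤ)^{n+1}`, `n ≥ 1`, `|β| ≤ 1/(4N (8n+1)² e²)`, every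
base (magnetic) twist tensor `m` and every electric flux `e ≠ 0`:
`‖e^{-βF(e,m)}‖ ≤ (e^{η} - 1) · W{m}`, `η = 2(n+1)² L^{n+1} e^{-L²}` (`W{m} = TwistedSector.twistZ … (twistOfTensor N m) β L > 0`).
Proof: (5.4) minus the vanishing constant term (`sum_fluxCharacter`), `|e^{-2πi(k·e)/N}| = 1`, and `|W{m+k}/W{m} - 1| ≤ e^{η} - 1` for
every temporal sector by `CentralTwist.abs_log_twistZ_sub_log_twistZ_le` (all twist sectors at once).
[cite: tHooft1979Flux, §5 eq. (5.4) and §7.2 eq. (7.5)] [cite: ItoSeiler2008Further, §2 Thm 2.2 (1)]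
[cite: Tomboulis2007Confinement, §6.1 eqs. (6.2)–(6.3) and §6.2 eqs. (6.10)–(6.14)] -/
theorem norm_electricFluxWeight_le (hn : 1 ≤ n) {β : ℝ}
    (hβ : |β| ≤ 1 / (4 * N * ((((8 * n : ℕ) : ℝ) + 1) ^ 2 * Real.exp 2))) (L : ℕ) [NeZero L]
    (m : QuantumLattice.Plane (n + 1) → ZMod N) {e : Fin n → ZMod N} (he : e ≠ 0) :
    ‖electricFluxWeight N L β m e‖ ≤
      (Real.exp (2 * ((n + 1 : ℕ) : ℝ) ^ 2 * (L : ℝ) ^ (n + 1) * Real.exp (-((L : ℝ) ^ 2))) - 1) *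
        TwistedSector.twistZ (fundamentalRep (Fin N)) (QuantumLattice.twistOfTensor N m) β L := by
  haveI : SecondCountableTopology (Matrix (Fin N) (Fin N) ℂ) :=
    inferInstanceAs (SecondCountableTopology (Fin N → Fin N → ℂ))
  haveI : SecondCountableTopology (Matrix.specialUnitaryGroup (Fin N) ℂ) :=
    TopologicalSpace.Subtype.secondCountableTopology _
  set η : ℝ := 2 * ((n + 1 : ℕ) : ℝ) ^ 2 * (L : ℝ) ^ (n + 1) * Real.exp (-((L : ℝ) ^ 2)) with hη
  set W₀ : ℝ := TwistedSector.twistZ (fundamentalRep (Fin N)) (QuantumLattice.twistOfTensor N m) β L with hW₀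
  have hW₀pos : 0 < W₀ := TwistedSector.twistZ_pos _ (continuous_fundamentalRep (Fin N)) _ β L
  have hd : 2 ≤ n + 1 := by omega
  have hβ' : |β| ≤ 1 / (4 * N * ((((8 * (n + 1 - 1) : ℕ) : ℝ) + 1) ^ 2 * Real.exp 2)) := by
    rw [Nat.add_sub_cancel]; exact hβ
  -- each temporal sector is within a factor e^{±η} of W₀
  have hsector : ∀ k : Fin n → ZMod N,
      |TwistedSector.twistZ (fundamentalRep (Fin N)) (QuantumLattice.twistOfTensor N (m + temporalTensor k)) β L - W₀| ≤
        (Real.exp η - 1) * W₀ := by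
    intro k
    have hWk : 0 < TwistedSector.twistZ (fundamentalRep (Fin N)) (QuantumLattice.twistOfTensor N (m + temporalTensor k)) β L :=
      TwistedSector.twistZ_pos _ (continuous_fundamentalRep (Fin N)) _ β L
    have hlog := CentralTwist.abs_log_twistZ_sub_log_twistZ_le (d := n + 1) (L := L) (fundamentalRep (Fin N))
      (continuous_fundamentalRep (Fin N)) hβ' (QuantumLattice.twistOfTensor N (m + temporalTensor k)) (QuantumLattice.twistOfTensor N m)
    have hratio := abs_div_sub_one_le_of_abs_log_sub_le hWk hW₀pos hlog
    have hrw : TwistedSector.twistZ (fundamentalRep (Fin N)) (QuantumLattice.twistOfTensor N (m + temporalTensor k)) β L - W₀ =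
        (TwistedSector.twistZ (fundamentalRep (Fin N)) (QuantumLattice.twistOfTensor N (m + temporalTensor k)) β L / W₀ - 1) * W₀ := by
      field_simp
    rw [hrw, abs_mul, abs_of_pos hW₀pos]
    exact mul_le_mul_of_nonneg_right hratio hW₀pos.le
  -- the Fourier sum
  rw [electricFluxWeight_eq_sum_sub L β m he, norm_mul, norm_inv, norm_pow, Complex.norm_natCast]
  have hNpos : (0 : ℝ) < (N : ℝ) ^ n := by
    have : (0 : ℝ) < N := by exact_mod_cast Nat.pos_of_ne_zero (NeZero.ne N)
    positivity
  have hsum : ‖∑ k : Fin n → ZMod N, fluxCharacter e k *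
      ((TwistedSector.twistZ (fundamentalRep (Fin N)) (QuantumLattice.twistOfTensor N (m + temporalTensor k)) β L : ℂ) -
        (W₀ : ℂ))‖ ≤ (N : ℝ) ^ n * ((Real.exp η - 1) * W₀) := by
    refine (norm_sum_le _ _).trans ?_
    have hterm : ∀ k : Fin n → ZMod N, ‖fluxCharacter e k *
        ((TwistedSector.twistZ (fundamentalRep (Fin N)) (QuantumLattice.twistOfTensor N (m + temporalTensor k)) β L : ℂ) -
          (W₀ : ℂ))‖ ≤ (Real.exp η - 1) * W₀ := by
      intro k
      rw [norm_mul, norm_fluxCharacter, one_mul, ← Complex.ofReal_sub, Complex.norm_real, Real.norm_eq_abs]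
      exact hsector k
    refine (Finset.sum_le_sum fun k _ => hterm k).trans ?_
    rw [Finset.sum_const, Finset.card_univ, nsmul_eq_mul, Fintype.card_pi, Finset.prod_const, ZMod.card, Finset.card_univ,
      Fintype.card_fin, Nat.cast_pow]
  calc ((N : ℝ) ^ n)⁻¹ * ‖∑ k : Fin n → ZMod N, fluxCharacter e k *
        ((TwistedSector.twistZ (fundamentalRep (Fin N)) (QuantumLattice.twistOfTensor N (m + temporalTensor k)) β L : ℂ) -
          (W₀ : ℂ))‖
      ≤ ((N : ℝ) ^ n)⁻¹ * ((N : ℝ) ^ n * ((Real.exp η - 1) * W₀)) :=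
        mul_le_mul_of_nonneg_left hsum (inv_nonneg.2 hNpos.le)
    _ = (Real.exp η - 1) * W₀ := by
        field_simp

/-- The zero-flux weight dominates the base sector up to `e^{-η}`: `e^{-η} W{m} ≤ e^{-βF(0,m)}` (real and positive), since every
temporal sector has `W{m+k} ≥ e^{-η} W{m}`. [cite: tHooft1979Flux, §5 eq. (5.4)] [cite: ItoSeiler2008Further, §2 Thm 2.2 (1)] -/
theorem exp_neg_mul_twistZ_le_re_electricFluxWeight_zero (hn : 1 ≤ n) {β : ℝ}
    (hβ : |β| ≤ 1 / (4 * N * ((((8 * n : ℕ) : ℝ) + 1) ^ 2 * Real.exp 2))) (L : ℕ) [NeZero L]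
    (m : QuantumLattice.Plane (n + 1) → ZMod N) :
    Real.exp (-(2 * ((n + 1 : ℕ) : ℝ) ^ 2 * (L : ℝ) ^ (n + 1) * Real.exp (-((L : ℝ) ^ 2)))) *
        TwistedSector.twistZ (fundamentalRep (Fin N)) (QuantumLattice.twistOfTensor N m) β L ≤
      (electricFluxWeight N L β m 0).re := by
  haveI : SecondCountableTopology (Matrix (Fin N) (Fin N) ℂ) :=
    inferInstanceAs (SecondCountableTopology (Fin N → Fin N → ℂ))
  haveI : SecondCountableTopology (Matrix.specialUnitaryGroup (Fin N) ℂ) :=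
    TopologicalSpace.Subtype.secondCountableTopology _
  set η : ℝ := 2 * ((n + 1 : ℕ) : ℝ) ^ 2 * (L : ℝ) ^ (n + 1) * Real.exp (-((L : ℝ) ^ 2)) with hη
  set W₀ : ℝ := TwistedSector.twistZ (fundamentalRep (Fin N)) (QuantumLattice.twistOfTensor N m) β L with hW₀
  have hW₀pos : 0 < W₀ := TwistedSector.twistZ_pos _ (continuous_fundamentalRep (Fin N)) _ β L
  have hd : 2 ≤ n + 1 := by omega
  have hβ' : |β| ≤ 1 / (4 * N * ((((8 * (n + 1 - 1) : ℕ) : ℝ) + 1) ^ 2 * Real.exp 2)) := by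
    rw [Nat.add_sub_cancel]; exact hβ
  have hsector : ∀ k : Fin n → ZMod N, Real.exp (-η) * W₀ ≤
      TwistedSector.twistZ (fundamentalRep (Fin N)) (QuantumLattice.twistOfTensor N (m + temporalTensor k)) β L := by
    intro k
    have hWk : 0 < TwistedSector.twistZ (fundamentalRep (Fin N)) (QuantumLattice.twistOfTensor N (m + temporalTensor k)) β L :=
      TwistedSector.twistZ_pos _ (continuous_fundamentalRep (Fin N)) _ β L
    have hlog := CentralTwist.abs_log_twistZ_sub_log_twistZ_le (d := n + 1) (L := L) (fundamentalRep (Fin N))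
      (continuous_fundamentalRep (Fin N)) hβ' (QuantumLattice.twistOfTensor N (m + temporalTensor k)) (QuantumLattice.twistOfTensor N m)
    rw [abs_le] at hlog
    have h1 : Real.log W₀ - η ≤
        Real.log (TwistedSector.twistZ (fundamentalRep (Fin N)) (QuantumLattice.twistOfTensor N (m + temporalTensor k)) β L) := by
      linarith [hlog.1]
    have h2 := Real.exp_le_exp.2 h1
    rwa [Real.exp_sub, Real.exp_log hW₀pos, Real.exp_log hWk, div_eq_mul_inv, ← Real.exp_neg, mul_comm] at h2
  rw [electricFluxWeight_zero, Complex.mul_re]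
  have hre : (∑ k : Fin n → ZMod N,
      (TwistedSector.twistZ (fundamentalRep (Fin N)) (QuantumLattice.twistOfTensor N (m + temporalTensor k)) β L : ℂ)).re =
      ∑ k : Fin n → ZMod N,
        TwistedSector.twistZ (fundamentalRep (Fin N)) (QuantumLattice.twistOfTensor N (m + temporalTensor k)) β L := by
    rw [← Complex.ofReal_sum, Complex.ofReal_re]
  have him : (∑ k : Fin n → ZMod N,
      (TwistedSector.twistZ (fundamentalRep (Fin N)) (QuantumLattice.twistOfTensor N (m + temporalTensor k)) β L : ℂ)).im = 0 := by
    rw [← Complex.ofReal_sum, Complex.ofReal_im]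
  have hinvre : (((N : ℂ) ^ n)⁻¹).re = ((N : ℝ) ^ n)⁻¹ := by
    rw [← Complex.ofReal_natCast, ← Complex.ofReal_pow, ← Complex.ofReal_inv, Complex.ofReal_re]
  have hinvim : (((N : ℂ) ^ n)⁻¹).im = 0 := by
    rw [← Complex.ofReal_natCast, ← Complex.ofReal_pow, ← Complex.ofReal_inv, Complex.ofReal_im]
  rw [hre, him, hinvre, hinvim, mul_zero, sub_zero]
  have hNpos : (0 : ℝ) < (N : ℝ) ^ n := by
    have : (0 : ℝ) < N := by exact_mod_cast Nat.pos_of_ne_zero (NeZero.ne N)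
    positivity
  have hcard : ∑ _k : Fin n → ZMod N, Real.exp (-η) * W₀ = (N : ℝ) ^ n * (Real.exp (-η) * W₀) := by
    rw [Finset.sum_const, Finset.card_univ, nsmul_eq_mul, Fintype.card_pi, Finset.prod_const, ZMod.card, Finset.card_univ,
      Fintype.card_fin, Nat.cast_pow]
  have hsum := Finset.sum_le_sum fun k (_ : k ∈ (Finset.univ : Finset (Fin n → ZMod N))) => hsector k
  rw [hcard] at hsum
  calc Real.exp (-η) * W₀ = ((N : ℝ) ^ n)⁻¹ * ((N : ℝ) ^ n * (Real.exp (-η) * W₀)) := by field_simp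
    _ ≤ ((N : ℝ) ^ n)⁻¹ * ∑ k : Fin n → ZMod N,
          TwistedSector.twistZ (fundamentalRep (Fin N)) (QuantumLattice.twistOfTensor N (m + temporalTensor k)) β L :=
        mul_le_mul_of_nonneg_left hsum (inv_nonneg.2 hNpos.le)

/-- **★★ 't Hooft's electric fluxes are heavy at strong coupling, relative form**: for `e ≠ 0`,
`‖e^{-βF(e,m)}‖ ≤ e^{η}(e^{η} - 1) · Re e^{-βF(0,m)}`, `η = 2(n+1)² L^{n+1} e^{-L²}` — the Boltzmann weight of every non-zero
electric flux, relative to the zero-flux weight in the same magnetic sector, is exponentially small in the cross-section `L²`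
(so `β(F(e,m) - F(0,m)) ≥ L² - O(log L)` grows like the AREA, i.e. the flux energy grows linearly in the box size at `β = L`:
"heavy", (7.5)). [cite: tHooft1979Flux, §5 eq. (5.4) and §7.2 eq. (7.5)] [cite: ItoSeiler2008Further, §2 Thm 2.2 (1)]
[cite: Tomboulis2007Confinement, §6.1 eqs. (6.2)–(6.3)] -/
theorem norm_electricFluxWeight_le_mul_zero (hn : 1 ≤ n) {β : ℝ}
    (hβ : |β| ≤ 1 / (4 * N * ((((8 * n : ℕ) : ℝ) + 1) ^ 2 * Real.exp 2))) (L : ℕ) [NeZero L]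
    (m : QuantumLattice.Plane (n + 1) → ZMod N) {e : Fin n → ZMod N} (he : e ≠ 0) :
    ‖electricFluxWeight N L β m e‖ ≤
      Real.exp (2 * ((n + 1 : ℕ) : ℝ) ^ 2 * (L : ℝ) ^ (n + 1) * Real.exp (-((L : ℝ) ^ 2))) *
        (Real.exp (2 * ((n + 1 : ℕ) : ℝ) ^ 2 * (L : ℝ) ^ (n + 1) * Real.exp (-((L : ℝ) ^ 2))) - 1) *
          (electricFluxWeight N L β m 0).re := by
  set η : ℝ := 2 * ((n + 1 : ℕ) : ℝ) ^ 2 * (L : ℝ) ^ (n + 1) * Real.exp (-((L : ℝ) ^ 2)) with hη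
  have h1 := norm_electricFluxWeight_le hn hβ L m he
  have h2 := exp_neg_mul_twistZ_le_re_electricFluxWeight_zero (N := N) hn hβ L m
  have hW₀pos : 0 < TwistedSector.twistZ (fundamentalRep (Fin N)) (QuantumLattice.twistOfTensor N m) β L :=
    TwistedSector.twistZ_pos _ (continuous_fundamentalRep (Fin N)) _ β L
  have hη0 : 0 ≤ η := by positivity
  have hE : 0 ≤ Real.exp η - 1 := by linarith [Real.add_one_le_exp η]
  -- W₀ ≤ e^{η} · Re w(0)
  have h3 : TwistedSector.twistZ (fundamentalRep (Fin N)) (QuantumLattice.twistOfTensor N m) β L ≤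
      Real.exp η * (electricFluxWeight N L β m 0).re := by
    have hprod : Real.exp η * Real.exp (-η) = 1 := by rw [← Real.exp_add, add_neg_cancel, Real.exp_zero]
    have := mul_le_mul_of_nonneg_left h2 (Real.exp_pos η).le
    calc TwistedSector.twistZ (fundamentalRep (Fin N)) (QuantumLattice.twistOfTensor N m) β L
        = Real.exp η * (Real.exp (-η) * TwistedSector.twistZ (fundamentalRep (Fin N)) (QuantumLattice.twistOfTensor N m) β L) := by
          rw [← mul_assoc, hprod, one_mul]
      _ ≤ Real.exp η * (electricFluxWeight N L β m 0).re := this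
  calc ‖electricFluxWeight N L β m e‖
      ≤ (Real.exp η - 1) * TwistedSector.twistZ (fundamentalRep (Fin N)) (QuantumLattice.twistOfTensor N m) β L := h1
    _ ≤ (Real.exp η - 1) * (Real.exp η * (electricFluxWeight N L β m 0).re) := mul_le_mul_of_nonneg_left h3 hE
    _ = Real.exp η * (Real.exp η - 1) * (electricFluxWeight N L β m 0).re := by ring

end StrongCoupling

/-! ## Revision 1 (lit-2 g25): magnetic fluxes are LIGHT at strong coupling ('t Hooft §7.1, §8 (8.10)–(8.11))

't Hooft §7.1: "exactly `N²` combinations must give vanishing F. Let us call these the "light" fluxes. The others send F to infinity.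
These we call "heavy" fluxes … From now on we will assume that the magnetic fluxes are light and the electric ones heavy (confinement
mode)"; §8 (8.10)–(8.11): `e^{-βF_m(m,0;a,β)} → e^{-βE_m(m,0;a)}`, `E_1(m_1, a) = R(m_1) a_1 e^{-ρ a_2 a_3}` — "the flux energy is
proportional to the length of the flux lines, and decreases exponentially with the area through which the flux lines go. … this
behaviour of the magnetic fluxes is quite opposite to that of the confining electric fluxes."  At strong coupling on the finite symmetric
torus this is a theorem (below): the zero-electric-flux weight `e^{-βF(0,m)}` is real and positive, and for ANY two base tensors `m, m'`
(in particular a magnetic flux `m` versus no flux `0`) `e^{-η} ≤ e^{-βF(0,m)}/e^{-βF(0,m')} ≤ e^{η}`, `η = 2(n+1)² L^{n+1} e^{-L²}`: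
`β|F(0,m) - F(0,m')| ≤ η` is exponentially small in the AREA `L²` ("light"), while (above) every `e ≠ 0` costs `β(F(e,m) - F(0,m)) ≥
L² - O(log L)` ("heavy").  Still finite volume, strong coupling, symmetric box; no string constant `ρ` and no limit is extracted.
-/

section LightMagneticFlux

/-- The zero-electric-flux weight is the plain average `(1/N^n) Σ_k W{m+k}`: its real part. [cite: tHooft1979Flux, §5 eq. (5.4)] -/
theorem re_electricFluxWeight_zero (L : ℕ) [NeZero L] (β : ℝ) (m : QuantumLattice.Plane (n + 1) → ZMod N) :
    (electricFluxWeight N L β m 0).re =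
      ((N : ℝ) ^ n)⁻¹ * ∑ k : Fin n → ZMod N,
        TwistedSector.twistZ (fundamentalRep (Fin N)) (QuantumLattice.twistOfTensor N (m + temporalTensor k)) β L := by
  rw [electricFluxWeight_zero, ← Complex.ofReal_sum, ← Complex.ofReal_natCast, ← Complex.ofReal_pow, ← Complex.ofReal_inv,
    ← Complex.ofReal_mul, Complex.ofReal_re]

/-- The zero-electric-flux weight is real. [cite: tHooft1979Flux, §5 eq. (5.4)] -/
theorem im_electricFluxWeight_zero (L : ℕ) [NeZero L] (β : ℝ) (m : QuantumLattice.Plane (n + 1) → ZMod N) :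
    (electricFluxWeight N L β m 0).im = 0 := by
  rw [electricFluxWeight_zero, ← Complex.ofReal_sum, ← Complex.ofReal_natCast, ← Complex.ofReal_pow, ← Complex.ofReal_inv,
    ← Complex.ofReal_mul, Complex.ofReal_im]

/-- The zero-electric-flux weight is positive (every twisted partition function is, `TwistedSector.twistZ_pos`), at every coupling.
[cite: tHooft1979Flux, §5 eq. (5.4) and §7.1 "W in eq. (5.4) must be positive"] -/
theorem re_electricFluxWeight_zero_pos (L : ℕ) [NeZero L] (β : ℝ) (m : QuantumLattice.Plane (n + 1) → ZMod N) :
    0 < (electricFluxWeight N L β m 0).re := by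
  haveI : SecondCountableTopology (Matrix (Fin N) (Fin N) ℂ) :=
    inferInstanceAs (SecondCountableTopology (Fin N → Fin N → ℂ))
  haveI : SecondCountableTopology (Matrix.specialUnitaryGroup (Fin N) ℂ) :=
    TopologicalSpace.Subtype.secondCountableTopology _
  rw [re_electricFluxWeight_zero]
  have hNpos : (0 : ℝ) < (N : ℝ) ^ n := by
    have : (0 : ℝ) < N := by exact_mod_cast Nat.pos_of_ne_zero (NeZero.ne N)
    positivity
  exact mul_pos (inv_pos.2 hNpos) (Finset.sum_pos
    (fun k _ => TwistedSector.twistZ_pos _ (continuous_fundamentalRep (Fin N)) _ β L) Finset.univ_nonempty)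

/-- **★★ Sectorwise comparison of the zero-electric-flux weights at strong coupling**: for `|β| ≤ 1/(4N (8n+1)² e²)`, `n ≥ 1`, and ANY
two base (magnetic) twist tensors `m, m'`: `e^{-βF(0,m)} ≤ e^{η} · e^{-βF(0,m')}`, `η = 2(n+1)² L^{n+1} e^{-L²}` — termwise
`W{m+k} ≤ e^{η} W{m'+k}` for every temporal twist `k` by the all-sector bound `CentralTwist.abs_log_twistZ_sub_log_twistZ_le`, then
average over `k`. [cite: tHooft1979Flux, §5 eq. (5.4), §7.1 and §8 eqs. (8.10)–(8.11)] [cite: ItoSeiler2008Further, §2 Thm 2.2 (1)]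
[cite: Tomboulis2007Confinement, §6.2 eqs. (6.10)–(6.14)] -/
theorem re_electricFluxWeight_zero_le_exp_mul (hn : 1 ≤ n) {β : ℝ}
    (hβ : |β| ≤ 1 / (4 * N * ((((8 * n : ℕ) : ℝ) + 1) ^ 2 * Real.exp 2))) (L : ℕ) [NeZero L]
    (m m' : QuantumLattice.Plane (n + 1) → ZMod N) :
    (electricFluxWeight N L β m 0).re ≤
      Real.exp (2 * ((n + 1 : ℕ) : ℝ) ^ 2 * (L : ℝ) ^ (n + 1) * Real.exp (-((L : ℝ) ^ 2))) *
        (electricFluxWeight N L β m' 0).re := by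
  haveI : SecondCountableTopology (Matrix (Fin N) (Fin N) ℂ) :=
    inferInstanceAs (SecondCountableTopology (Fin N → Fin N → ℂ))
  haveI : SecondCountableTopology (Matrix.specialUnitaryGroup (Fin N) ℂ) :=
    TopologicalSpace.Subtype.secondCountableTopology _
  set η : ℝ := 2 * ((n + 1 : ℕ) : ℝ) ^ 2 * (L : ℝ) ^ (n + 1) * Real.exp (-((L : ℝ) ^ 2)) with hη
  have hd : 2 ≤ n + 1 := by omega
  have hβ' : |β| ≤ 1 / (4 * N * ((((8 * (n + 1 - 1) : ℕ) : ℝ) + 1) ^ 2 * Real.exp 2)) := by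
    rw [Nat.add_sub_cancel]; exact hβ
  -- termwise: W{m+k} ≤ e^{η} W{m'+k}
  have hsector : ∀ k : Fin n → ZMod N,
      TwistedSector.twistZ (fundamentalRep (Fin N)) (QuantumLattice.twistOfTensor N (m + temporalTensor k)) β L ≤
        Real.exp η *
          TwistedSector.twistZ (fundamentalRep (Fin N)) (QuantumLattice.twistOfTensor N (m' + temporalTensor k)) β L := by
    intro k
    have hWk : 0 < TwistedSector.twistZ (fundamentalRep (Fin N)) (QuantumLattice.twistOfTensor N (m + temporalTensor k)) β L :=
      TwistedSector.twistZ_pos _ (continuous_fundamentalRep (Fin N)) _ β L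
    have hWk' : 0 < TwistedSector.twistZ (fundamentalRep (Fin N)) (QuantumLattice.twistOfTensor N (m' + temporalTensor k)) β L :=
      TwistedSector.twistZ_pos _ (continuous_fundamentalRep (Fin N)) _ β L
    have hlog := CentralTwist.abs_log_twistZ_sub_log_twistZ_le (d := n + 1) (L := L) (fundamentalRep (Fin N))
      (continuous_fundamentalRep (Fin N)) hβ' (QuantumLattice.twistOfTensor N (m + temporalTensor k))
      (QuantumLattice.twistOfTensor N (m' + temporalTensor k))
    rw [abs_le] at hlog
    have h1 : Real.log (TwistedSector.twistZ (fundamentalRep (Fin N)) (QuantumLattice.twistOfTensor N (m + temporalTensor k)) β L) ≤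
        η + Real.log (TwistedSector.twistZ (fundamentalRep (Fin N)) (QuantumLattice.twistOfTensor N (m' + temporalTensor k)) β L) := by
      linarith [hlog.2]
    have h2 := Real.exp_le_exp.2 h1
    rwa [Real.exp_add, Real.exp_log hWk, Real.exp_log hWk'] at h2
  rw [re_electricFluxWeight_zero, re_electricFluxWeight_zero]
  have hNpos : (0 : ℝ) < (N : ℝ) ^ n := by
    have : (0 : ℝ) < N := by exact_mod_cast Nat.pos_of_ne_zero (NeZero.ne N)
    positivity
  have hsum := Finset.sum_le_sum fun k (_ : k ∈ (Finset.univ : Finset (Fin n → ZMod N))) => hsector k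
  rw [← Finset.mul_sum] at hsum
  calc ((N : ℝ) ^ n)⁻¹ * ∑ k : Fin n → ZMod N,
        TwistedSector.twistZ (fundamentalRep (Fin N)) (QuantumLattice.twistOfTensor N (m + temporalTensor k)) β L
      ≤ ((N : ℝ) ^ n)⁻¹ * (Real.exp η * ∑ k : Fin n → ZMod N,
          TwistedSector.twistZ (fundamentalRep (Fin N)) (QuantumLattice.twistOfTensor N (m' + temporalTensor k)) β L) :=
        mul_le_mul_of_nonneg_left hsum (inv_nonneg.2 hNpos.le)
    _ = Real.exp η * (((N : ℝ) ^ n)⁻¹ * ∑ k : Fin n → ZMod N,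
          TwistedSector.twistZ (fundamentalRep (Fin N)) (QuantumLattice.twistOfTensor N (m' + temporalTensor k)) β L) := by
        ring

/-- **★★ Magnetic fluxes are light at strong coupling**: for `|β| ≤ 1/(4N (8n+1)² e²)`, `n ≥ 1`, and ANY two base (magnetic) twist
tensors `m, m'` — in particular `m` versus `m' = 0` — `β|F(0,m) - F(0,m')| = |ln e^{-βF(0,m)} - ln e^{-βF(0,m')}| ≤ 2(n+1)² L^{n+1} e^{-L²}`:
the free energy of every magnetic flux (at zero electric flux) is exponentially small in the AREA `L²` of the finite symmetric box,
't Hooft's "light magnetic fluxes" (8.11) `E_m ∝ a e^{-ρ a²}` of the confinement mode, here at strong coupling (rate constant `1`, not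
the string constant). [cite: tHooft1979Flux, §7.1 and §8 eqs. (8.10)–(8.11)] [cite: ItoSeiler2008Further, §2 Thm 2.2 (1)]
[cite: Tomboulis2007Confinement, §6.2 eqs. (6.10)–(6.14)] -/
theorem abs_log_re_electricFluxWeight_zero_sub_le (hn : 1 ≤ n) {β : ℝ}
    (hβ : |β| ≤ 1 / (4 * N * ((((8 * n : ℕ) : ℝ) + 1) ^ 2 * Real.exp 2))) (L : ℕ) [NeZero L]
    (m m' : QuantumLattice.Plane (n + 1) → ZMod N) :
    |Real.log (electricFluxWeight N L β m 0).re - Real.log (electricFluxWeight N L β m' 0).re| ≤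
      2 * ((n + 1 : ℕ) : ℝ) ^ 2 * (L : ℝ) ^ (n + 1) * Real.exp (-((L : ℝ) ^ 2)) := by
  set η : ℝ := 2 * ((n + 1 : ℕ) : ℝ) ^ 2 * (L : ℝ) ^ (n + 1) * Real.exp (-((L : ℝ) ^ 2)) with hη
  have h1 := re_electricFluxWeight_zero_le_exp_mul hn hβ L m m'
  have h2 := re_electricFluxWeight_zero_le_exp_mul hn hβ L m' m
  have hp := re_electricFluxWeight_zero_pos (N := N) L β m
  have hp' := re_electricFluxWeight_zero_pos (N := N) L β m'
  have hl1 := Real.log_le_log hp h1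
  have hl2 := Real.log_le_log hp' h2
  rw [Real.log_mul (Real.exp_pos _).ne' hp'.ne', Real.log_exp] at hl1
  rw [Real.log_mul (Real.exp_pos _).ne' hp.ne', Real.log_exp] at hl2
  rw [abs_le]
  constructor <;> linarith

/-- Ratio form: `|e^{-βF(0,m)}/e^{-βF(0,m')} - 1| ≤ e^{η} - 1`, `η = 2(n+1)² L^{n+1} e^{-L²}`, for any two base tensors at strong coupling.
[cite: tHooft1979Flux, §7.1 and §8 eqs. (8.10)–(8.11)] [cite: ItoSeiler2008Further, §2 Thm 2.2 (1)] -/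
theorem abs_re_electricFluxWeight_zero_div_sub_one_le (hn : 1 ≤ n) {β : ℝ}
    (hβ : |β| ≤ 1 / (4 * N * ((((8 * n : ℕ) : ℝ) + 1) ^ 2 * Real.exp 2))) (L : ℕ) [NeZero L]
    (m m' : QuantumLattice.Plane (n + 1) → ZMod N) :
    |(electricFluxWeight N L β m 0).re / (electricFluxWeight N L β m' 0).re - 1| ≤
      Real.exp (2 * ((n + 1 : ℕ) : ℝ) ^ 2 * (L : ℝ) ^ (n + 1) * Real.exp (-((L : ℝ) ^ 2))) - 1 :=
  abs_div_sub_one_le_of_abs_log_sub_le (re_electricFluxWeight_zero_pos (N := N) L β m)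
    (re_electricFluxWeight_zero_pos (N := N) L β m') (abs_log_re_electricFluxWeight_zero_sub_le hn hβ L m m')

/-- **Heavy electric versus light magnetic, relative to the flux-free sector**: for `e ≠ 0` and ANY base tensors `m, m'`,
`‖e^{-βF(e,m)}‖ ≤ e^{2η}(e^{η} - 1) · e^{-βF(0,m')}` — every non-zero electric flux in every magnetic sector is exponentially
suppressed (in the area `L²`) relative to every zero-electric-flux sector, in particular relative to the vacuum `(e, m) = (0, 0)`.
[cite: tHooft1979Flux, §7.1, §7.2 eq. (7.5) and §8 eqs. (8.10)–(8.11)] [cite: ItoSeiler2008Further, §2 Thm 2.2 (1)] -/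
theorem norm_electricFluxWeight_le_mul_zero_of_ne (hn : 1 ≤ n) {β : ℝ}
    (hβ : |β| ≤ 1 / (4 * N * ((((8 * n : ℕ) : ℝ) + 1) ^ 2 * Real.exp 2))) (L : ℕ) [NeZero L]
    (m m' : QuantumLattice.Plane (n + 1) → ZMod N) {e : Fin n → ZMod N} (he : e ≠ 0) :
    ‖electricFluxWeight N L β m e‖ ≤
      Real.exp (2 * ((n + 1 : ℕ) : ℝ) ^ 2 * (L : ℝ) ^ (n + 1) * Real.exp (-((L : ℝ) ^ 2))) ^ 2 *
        (Real.exp (2 * ((n + 1 : ℕ) : ℝ) ^ 2 * (L : ℝ) ^ (n + 1) * Real.exp (-((L : ℝ) ^ 2))) - 1) *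
          (electricFluxWeight N L β m' 0).re := by
  set η : ℝ := 2 * ((n + 1 : ℕ) : ℝ) ^ 2 * (L : ℝ) ^ (n + 1) * Real.exp (-((L : ℝ) ^ 2)) with hη
  have h1 := norm_electricFluxWeight_le_mul_zero hn hβ L m he
  have h2 := re_electricFluxWeight_zero_le_exp_mul hn hβ L m m'
  have hη0 : 0 ≤ η := by positivity
  have hE : 0 ≤ Real.exp η * (Real.exp η - 1) := mul_nonneg (Real.exp_pos η).le (by linarith [Real.add_one_le_exp η])
  calc ‖electricFluxWeight N L β m e‖
      ≤ Real.exp η * (Real.exp η - 1) * (electricFluxWeight N L β m 0).re := h1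
    _ ≤ Real.exp η * (Real.exp η - 1) * (Real.exp η * (electricFluxWeight N L β m' 0).re) := mul_le_mul_of_nonneg_left h2 hE
    _ = Real.exp η ^ 2 * (Real.exp η - 1) * (electricFluxWeight N L β m' 0).re := by ring

end LightMagneticFlux

end THooftFlux

end Literature.MathematicalPhysics.QuantumFieldTheory

end
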